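import Literature.Topology.FourManifolds.RadialDiffeomorph
import Literature.Topology.FourManifolds.PalaisBallComplement
import Literature.Topology.FourManifolds.PalaisDiscSphere
import Literature.Topology.FourManifolds.ConnectedSumSpheres
import Literature.Topology.FourManifolds.ConnectedSum
import Literature.Topology.FourManifolds.GluingUniqueness
import Literature.Topology.FourManifolds.ConnectedSumData
import Literature.Topology.FourManifolds.CerfGammaFourProofs
import Literature.Topology.FourManifolds.CorkDecompositionSplitting
import HarnessLib

/-!
# `Sⁿ` is the identity element for the connected sum: `X # Sⁿ ≅ X`

Topic `Literature/Topology/FourManifolds`. This file **discharges named facts** of the tree: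

* `Literature.Topology.FourManifolds.nonempty_diffeomorph_of_isConnectedSum_sphere` (`CorkDecompositionSplitting.lean`, the
  leaf (U) under Matveyev's cork decomposition): if the smooth `n`-manifold `Q` is a connected sum
  (`Literature.Topology.FourManifolds.IsConnectedSum`, Kervaire–Milnor's relation along *arbitrary* discs `i₁ : ℝⁿ ↪ X`,
  `i₂ : ℝⁿ ↪ Sⁿ`) of `X` and the standard sphere `Sⁿ`, then `Q ≅ X`
  (`nonempty_diffeomorph_of_isConnectedSum_sphere_holds`);
* `Literature.Topology.FourManifolds.isConnectedSum_sphere_self` (`ConnectedSum.lean`): every nonempty smooth `n`-manifold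
  `M` is a connected sum `M # Sⁿ` with `P := M` (`isConnectedSum_sphere_self_holds`);

and, as a corollary of the first, a third one:

* `Literature.connectedSum_sphere_sphere n` (`ConnectedSumSpheres.lean`): a connected sum of two
  manifolds diffeomorphic to `Sⁿ` is diffeomorphic to `Sⁿ` (`connectedSum_sphere_sphere_holds`,
  via the transport of connected sums along diffeomorphisms of the *pieces*,
  `IsConnectedSum.of_diffeomorph_right`).

All are Kervaire–Milnor, *Groups of homotopy spheres I* (1963), §2, "`Sⁿ` serves as identity
element", Kosinski, *Differential Manifolds* (1993), VI.1.3; the first one for arbitrary discs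
rests on Palais' disc theorem in `Sⁿ`.

## Informal content and proof

1. **Lemmas on open gluings** (§1): the inclusion of an open submanifold is a smooth embedding
   (Mathlib's `Manifold.IsSmoothEmbedding.of_opens`);
   a cover `P = U ∪ V` by two open sets is an open gluing of `U` and `V` along equality
   (`IsOpenGluing.of_opens_union_eq_univ`); open gluings are transported along diffeomorphisms
   *of the pieces* (`IsOpenGluing.comp_diffeomorph_pieces`, by the tree's
   `Manifold.IsSmoothEmbedding.comp_diffeomorph`) and along equivalent relations.
2. **Palais' disc theorem in a sphere** is used in the ambient form of the tree's
   `exists_diffeomorph_apply_stereographic_symm_eq` (`PalaisDiscSphere.lean`; Palais 1960,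
   Thm. B; Hirsch, *Differential Topology*, Ch. 8, Thm. 3.1): for every smooth embedding
   `e : ℝⁿ → S` into the unit sphere `S` of an `(n+1)`-dimensional inner product space there are
   a diffeomorphism `Ψ` of `S` and a linear isometry `B` of `ℝⁿ` with `Ψ (σᵥ⁻¹ y) = e (B y)` for
   `‖y‖ ≤ 1`, `v = -e 0`; equivalently `Ψ ∘ (σᵥ⁻¹ ∘ S₀) = e` on the closed unit disc with
   `S₀ = B⁻¹`.
3. **The standard model** (§2, `ConnectedSumSphereData.isOpenGluing_connectedSumRel`): let
   `Φ : X ⊇ U → ℝⁿ` be a smooth chart onto `ℝⁿ`, `i₁ := Φ⁻¹`, and `i₂ := σᵥ⁻¹ ∘ S₀ : ℝⁿ → S` a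
   round disc centred at `-v`. Then `X` itself is the open gluing of `X ∖ {i₁ 0}` and
   `S ∖ {-v}` along Kervaire–Milnor's relation `i₁ (t • u) ∼ i₂ ((1 - t) • u)`: write
   `X = Uα ∪ Uβ` with `Uα := X ∖ i₁(B̄(0, 1/8))`, `Uβ := i₁(B(0, 1))`, and use the diffeomorphisms
   `α : X ∖ {i₁ 0} ≅ Uα`, the puncture expansion `h` of `RadialDiffeomorph.lean` transported along
   `Φ` (identity off `i₁(B̄(0, 3/4))`), and `β := i₁ ∘ g ∘ S₀⁻¹ ∘ σᵥ ∘ R : S ∖ {-v} ≅ Uβ` (`g` the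
   ball contraction, `R` the reflection of `S` in `vᗮ`, which exchanges `±v` and reads
   `z ↦ 4 z / ‖z‖²` in the chart `σᵥ`, `poleReflection_stereographic'_symm`). The identity
   `h (t • u) = g ((4 / (1 - t)) • u)` (`punctureExpansion_smul_eq`) shows that `α a = β b` iff
   `a ∼ b` (`ConnectedSumSphereData.α_eq_β_iff`).
4. **Assembly** (§2–§3). Given `Q = (X ∖ {i₁ 0}) ∪ (Sⁿ ∖ {i₂ 0})` glued along the relation for
   arbitrary discs, `exists_chart_of_isSmoothEmbedding` provides `Φ = i₁⁻¹`, step 2 provides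
   `Ψ` with `Ψ ∘ σᵥ⁻¹ ∘ S₀ = i₂` on the closed unit disc — which is all the relation sees — so
   that `Q` is also glued from `X ∖ {i₁ 0}` and `Sⁿ ∖ {-v}` along the relation for the round
   disc (`ConnectedSumSphereData.isOpenGluing_of_diffeomorph_apply_eq`), and uniqueness of open
   gluings (`IsOpenGluing.nonempty_diffeomorph`, `GluingUniqueness.lean`) gives `Q ≅ X`. For
   `isConnectedSum_sphere_self` take `Φ` from `exists_mem_maximalAtlas_target_eq_univ`,
   `S₀ := id` and any pole.

## Design

The sphere is the unit sphere of an arbitrary inner product space `V` with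
`Fact (finrank ℝ V = n + 1)` (as in `PalaisBallComplement.lean`), specialised to
`V = EuclideanSpace ℝ (Fin (n + 1))` only in §3, where Mathlib's `Fact` is supplied by `haveI` as
in `EuclideanSpace.instIsManifoldSphere`. The data `(Φ, v, S₀)` of the standard model are bundled
in the structure `ConnectedSumSphereData V n X` so that the two discs, the two open pieces and the
two diffeomorphisms `α`, `β` can be named. No orientation or connectedness hypothesis on `X` is
needed (the isometry `S₀` absorbs the orientation proviso of the disc theorem, `Sⁿ` having
orientation-reversing symmetries), and `isConnectedSum_sphere_self_holds` needs neither second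
countability nor compactness, exactly as the fact is stated. This file adds no instances and only
the local notations `𝔼 n`, `𝕊 n` of the other files of the topic.

## References

* M. A. Kervaire, J. W. Milnor, *Groups of homotopy spheres: I*, Ann. of Math. (2) 77 (1963),
  504–537, §2 ("`Sⁿ` serves as identity element", Lemma 2.1) [KervaireMilnor1963].
* A. A. Kosinski, *Differential Manifolds*, Academic Press (1993), Ch. VI, §1 (1.3)
  [Kosinski1993].
* R. S. Palais, *Extending diffeomorphisms*, Proc. Amer. Math. Soc. 11 (1960), 274–277, Thm. B
  [Palais1960].
* M. W. Hirsch, *Differential Topology*, GTM 33, Springer (1976), Ch. 8, Thm. 3.1 [HirschDT1976].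
-/

open scoped Manifold ContDiff Topology
open Set Function Metric Module

noncomputable section

universe u v w

namespace Literature.Topology.FourManifolds

/-! ### §1 Lemmas on open gluings -/

section GluingLemmas

variable {E H : Type*} [NormedAddCommGroup E] [NormedSpace ℝ E] [TopologicalSpace H]
  {I : ModelWithCorners ℝ E H}
  {P : Type*} [TopologicalSpace P] [ChartedSpace H P]

/-- **An open cover by two sets is an open gluing along equality**: if `U ∪ V = P` for open
`U, V ⊆ P`, then `P` is the open gluing of `U` and `V` along the relation `u = v` (in `P`), the
embeddings being the inclusions (Kosinski, *Differential Manifolds*, VI.1). [folklore] -/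
theorem IsOpenGluing.of_opens_union_eq_univ [IsManifold I ∞ P]
    (U V : TopologicalSpace.Opens P) (hUV : (U : Set P) ∪ V = univ) :
    IsOpenGluing I I I (A := U) (B := V) (P := P) (fun u v => (u : P) = v) := by
  refine ⟨Subtype.val, Subtype.val, Manifold.IsSmoothEmbedding.of_opens U, ?_,
    Manifold.IsSmoothEmbedding.of_opens V, ?_, ?_, fun u v => Iff.rfl⟩
  · rw [Subtype.range_coe_subtype]; exact U.isOpen
  · rw [Subtype.range_coe_subtype]; exact V.isOpen
  · simpa using hUV

variable {EA HA : Type*} [NormedAddCommGroup EA] [NormedSpace ℝ EA] [TopologicalSpace HA]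
  {IA : ModelWithCorners ℝ EA HA}
  {EB HB : Type*} [NormedAddCommGroup EB] [NormedSpace ℝ EB] [TopologicalSpace HB]
  {IB : ModelWithCorners ℝ EB HB}
  {A A' B B' : Type*} [TopologicalSpace A] [ChartedSpace HA A] [TopologicalSpace A']
  [ChartedSpace HA A'] [TopologicalSpace B] [ChartedSpace HB B] [TopologicalSpace B']
  [ChartedSpace HB B']

/-- **Open gluings are transported along diffeomorphisms of the pieces**: if `P` is the open
gluing of `A` and `B` along `R`, and `α : A' ≅ A`, `β : B' ≅ B` are diffeomorphisms, then `P` is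
the open gluing of `A'` and `B'` along `R (α a') (β b')` (compose the embeddings with `α`, `β`;
uses the tree's `Manifold.IsSmoothEmbedding.comp_diffeomorph`). [folklore] -/
theorem IsOpenGluing.comp_diffeomorph_pieces [IsManifold IA ∞ A] [IsManifold IA ∞ A']
    [IsManifold IB ∞ B] [IsManifold IB ∞ B'] {R : A → B → Prop}
    (h : IsOpenGluing IA IB I (A := A) (B := B) (P := P) R) (α : A' ≃ₘ⟮IA, IA⟯ A)
    (β : B' ≃ₘ⟮IB, IB⟯ B) :
    IsOpenGluing IA IB I (A := A') (B := B') (P := P) (fun a b => R (α a) (β b)) := by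
  obtain ⟨jA, jB, hA, hAo, hB, hBo, hU, hR⟩ := h
  have hαs : Function.Surjective (α : A' → A) := α.surjective
  have hβs : Function.Surjective (β : B' → B) := β.surjective
  refine ⟨jA ∘ α, jB ∘ β, hA.comp_diffeomorph α, ?_, hB.comp_diffeomorph β, ?_, ?_,
    fun a b => hR (α a) (β b)⟩
  · rwa [hαs.range_comp]
  · rwa [hβs.range_comp]
  · rwa [hαs.range_comp, hβs.range_comp]

omit [TopologicalSpace A'] [ChartedSpace HA A'] [TopologicalSpace B'] [ChartedSpace HB B'] in
/-- Open gluings along pointwise equivalent relations are the same. [folklore] -/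
theorem IsOpenGluing.of_forall_iff {R R' : A → B → Prop}
    (h : IsOpenGluing IA IB I (A := A) (B := B) (P := P) R) (hRR' : ∀ a b, R a b ↔ R' a b) :
    IsOpenGluing IA IB I (A := A) (B := B) (P := P) R' := by
  obtain ⟨jA, jB, hA, hAo, hB, hBo, hU, hR⟩ := h
  exact ⟨jA, jB, hA, hAo, hB, hBo, hU, fun a b => (hR a b).trans (hRR' a b)⟩

end GluingLemmas

section PieceTransport

variable {EP HP : Type*} [NormedAddCommGroup EP] [NormedSpace ℝ EP] [TopologicalSpace HP]
  {IP : ModelWithCorners ℝ EP HP}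
  {EM HM : Type*} [NormedAddCommGroup EM] [NormedSpace ℝ EM] [TopologicalSpace HM]
  {IM : ModelWithCorners ℝ EM HM}
  {EN HN : Type*} [NormedAddCommGroup EN] [NormedSpace ℝ EN] [TopologicalSpace HN]
  {IN : ModelWithCorners ℝ EN HN}
  {M N N' P : Type*} [TopologicalSpace M] [T2Space M] [ChartedSpace HM M]
  [TopologicalSpace N] [T2Space N] [ChartedSpace HN N] [TopologicalSpace N'] [T2Space N']
  [ChartedSpace HN N'] [TopologicalSpace P] [ChartedSpace HP P]

/-- **Being a connected sum is invariant under diffeomorphisms of the pieces**: if `P` is a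
connected sum `M # N` along the discs `i₁`, `i₂` and `ψ : N ≅ N'`, then `P` is a connected sum
`M # N'` along `i₁`, `ψ ∘ i₂` — compose the embedding of the punctured piece with the restriction
`N' ∖ {ψ (i₂ 0)} ≅ N ∖ {i₂ 0}` of `ψ⁻¹`; the relation only sees `i₂` through `ψ ∘ i₂`
(Kervaire–Milnor 1963, §2, "well defined"; the transport along diffeomorphisms of the *glued*
manifold is `IsConnectedSum.of_diffeomorph`, `ConnectedSumSpheres.lean`).
[cite: KervaireMilnor1963, §2] -/
theorem IsConnectedSum.of_diffeomorph_right [IsManifold IM ∞ M] [IsManifold IN ∞ N]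
    [IsManifold IN ∞ N'] (h : IsConnectedSum IP IM IN M N P) (ψ : N ≃ₘ⟮IN, IN⟯ N') :
    IsConnectedSum IP IM IN M N' P := by
  obtain ⟨i₁, i₂, h₁, h₂, hG⟩ := h
  have hmem : ∀ b : N', b ∈ puncture (ψ ∘ i₂) ↔ ψ.symm b ∈ puncture i₂ := fun b => by
    rw [mem_puncture, mem_puncture, comp_apply]
    constructor
    · intro h h'
      exact h (by rw [← h', Diffeomorph.apply_symm_apply])
    · intro h h'
      exact h (by rw [h', Diffeomorph.symm_apply_apply])
  refine ⟨i₁, ψ ∘ i₂, h₁, h₂.diffeomorph_comp ψ, ?_⟩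
  refine (hG.comp_diffeomorph_pieces (Diffeomorph.refl IM (↥(puncture i₁)) ∞)
    (opensCongr ψ.symm (puncture (ψ ∘ i₂)) (puncture i₂) hmem)).of_forall_iff fun a b => ?_
  simp only [Diffeomorph.coe_refl, id_eq]
  constructor
  · rintro ⟨u, t, hu, ht, ha, hb⟩
    refine ⟨u, t, hu, ht, ha, ?_⟩
    rw [coe_opensCongr_apply] at hb
    show (b : N') = ψ (i₂ ((1 - t) • u))
    rw [← hb, Diffeomorph.apply_symm_apply]
  · rintro ⟨u, t, hu, ht, ha, hb⟩
    refine ⟨u, t, hu, ht, ha, ?_⟩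
    rw [coe_opensCongr_apply, hb]
    exact ψ.symm_apply_apply _

/-- Symmetrically, a connected sum `M # N` along `i₁`, `i₂` is a connected sum `M' # N` along
`φ ∘ i₁`, `i₂` for every diffeomorphism `φ : M ≅ M'` (Kervaire–Milnor 1963, §2).
[cite: KervaireMilnor1963, §2] -/
theorem IsConnectedSum.of_diffeomorph_left {M' : Type*} [TopologicalSpace M'] [T2Space M']
    [ChartedSpace HM M'] [IsManifold IM ∞ M] [IsManifold IM ∞ M'] [IsManifold IN ∞ N]
    (h : IsConnectedSum IP IM IN M N P) (φ : M ≃ₘ⟮IM, IM⟯ M') :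
    IsConnectedSum IP IM IN M' N P :=
  ((h.symm).of_diffeomorph_right φ).symm

end PieceTransport

/-! ### §2 The standard model: `X` is the open gluing of `X ∖ {i₁ 0}` and `S ∖ {σᵥ⁻¹(S₀ 0)}` -/

section ChartTransportOn

variable {E : Type*} [NormedAddCommGroup E] [NormedSpace ℝ E] {M : Type*} [TopologicalSpace M]
  [ChartedSpace E M] [T2Space M] [ProperSpace E] {φ : OpenPartialHomeomorph M E}

/-- `contMDiff_chartTransport` for a map `s` of the model which is only smooth on an open set
`U ⊆ E` (and the identity off a ball): the transport is smooth at the points `x` with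
`x ∈ φ.source → φ x ∈ U`. [folklore] -/
theorem contMDiffOn_chartTransport (hφ : ContMDiffOn 𝓘(ℝ, E) 𝓘(ℝ, E) ∞ φ φ.source)
    (hφ' : ContMDiff 𝓘(ℝ, E) 𝓘(ℝ, E) ∞ φ.symm) (htarget : φ.target = univ)
    {s : E → E} {U : Set E} (hU : IsOpen U) (hsm : ContMDiffOn 𝓘(ℝ, E) 𝓘(ℝ, E) ∞ s U)
    {R : ℝ} (hs : ∀ y, R ≤ ‖y‖ → s y = y) :
    ContMDiffOn 𝓘(ℝ, E) 𝓘(ℝ, E) ∞ (chartTransport φ s) {x | x ∈ φ.source → φ x ∈ U} := by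
  intro x hx
  by_cases hxs : x ∈ φ.source
  · have hev : chartTransport φ s =ᶠ[𝓝 x] fun z ↦ φ.symm (s (φ z)) :=
      Filter.eventuallyEq_of_mem (φ.open_source.mem_nhds hxs)
        fun z hz ↦ chartTransport_of_mem s hz
    refine (ContMDiffAt.congr_of_eventuallyEq ?_ hev).contMDiffWithinAt
    exact hφ'.contMDiffAt.comp x ((hsm.contMDiffAt (hU.mem_nhds (hx hxs))).comp x
      (hφ.contMDiffAt (φ.open_source.mem_nhds hxs)))
  · have hK : IsClosed (φ.symm '' Metric.closedBall (0 : E) R) :=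
      ((isCompact_closedBall (0 : E) R).image_of_continuousOn
        (hφ'.continuous.continuousOn)).isClosed
    have hxK : x ∉ φ.symm '' Metric.closedBall (0 : E) R := by
      rintro ⟨y, -, rfl⟩
      exact hxs (φ.map_target (by simp [htarget]))
    have hev : chartTransport φ s =ᶠ[𝓝 x] id :=
      Filter.eventuallyEq_of_mem (hK.isOpen_compl.mem_nhds hxK)
        fun z hz ↦ chartTransport_eq_self hs hz
    exact (contMDiffAt_id.congr_of_eventuallyEq hev).contMDiffWithinAt

end ChartTransportOn

section StandardModel

variable {V : Type*} [NormedAddCommGroup V] {n : ℕ}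
  {X : Type*} [TopologicalSpace X] [ChartedSpace (EuclideanSpace ℝ (Fin n)) X]

variable (V n X) in
/-- Data for the standard model of `X # Sⁿ ≅ X`: a smooth chart `Φ` of `X` onto the whole model
space (so that `i₁ := Φ⁻¹ : ℝⁿ ↪ X` is an arbitrary equidimensional disc, cf.
`exists_chart_of_isSmoothEmbedding`), a pole `v` of the unit sphere `S ⊆ V` and a linear
isometry `S₀` of `ℝⁿ` (so that `i₂ := σᵥ⁻¹ ∘ S₀ : ℝⁿ ↪ S` is a round disc centred at `-v`).
[folklore] -/
structure ConnectedSumSphereData where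
  /-- a chart of `X` onto `ℝⁿ` -/
  Φ : OpenPartialHomeomorph X (EuclideanSpace ℝ (Fin n))
  /-- the chart is onto `ℝⁿ` -/
  target_eq : Φ.target = univ
  /-- the chart is smooth on its source -/
  contMDiffOn_Φ : ContMDiffOn (𝓡 n) (𝓡 n) ∞ Φ Φ.source
  /-- the inverse of the chart is smooth on all of `ℝⁿ` -/
  contMDiff_symm : ContMDiff (𝓡 n) (𝓡 n) ∞ Φ.symm
  /-- the pole opposite to the centre of the round disc -/
  v : sphere (0 : V) 1
  /-- the isometric reparametrisation of the round disc -/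
  S₀ : EuclideanSpace ℝ (Fin n) ≃ₗᵢ[ℝ] EuclideanSpace ℝ (Fin n)

namespace ConnectedSumSphereData

variable (D : ConnectedSumSphereData V n X)

/-! #### The disc `i₁ = Φ⁻¹` -/

/-- The disc `i₁ = Φ⁻¹ : ℝⁿ → X`. [folklore] -/
def i₁ : EuclideanSpace ℝ (Fin n) → X := D.Φ.symm

/-- `i₁ = Φ⁻¹`. [folklore] -/
theorem i₁_def : D.i₁ = D.Φ.symm := rfl

/-- `i₁ y ∈ Φ.source`. [folklore] -/
theorem i₁_mem_source (y : EuclideanSpace ℝ (Fin n)) : D.i₁ y ∈ D.Φ.source :=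
  D.Φ.map_target (by rw [D.target_eq]; exact mem_univ y)

/-- `Φ (i₁ y) = y`. [folklore] -/
theorem Φ_i₁ (y : EuclideanSpace ℝ (Fin n)) : D.Φ (D.i₁ y) = y :=
  D.Φ.right_inv (by rw [D.target_eq]; exact mem_univ y)

/-- `i₁ (Φ x) = x` for `x ∈ Φ.source`. [folklore] -/
theorem i₁_Φ {x : X} (hx : x ∈ D.Φ.source) : D.i₁ (D.Φ x) = x := D.Φ.left_inv hx

/-- `i₁` is injective. [folklore] -/
theorem injective_i₁ : Injective D.i₁ := fun y y' h => by
  rw [← D.Φ_i₁ y, ← D.Φ_i₁ y', h]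

/-- `Φ.source = range i₁`. [folklore] -/
theorem source_eq : D.Φ.source = range D.i₁ := by
  rw [i₁_def, ← D.Φ.symm_image_target_eq_source, D.target_eq, image_univ]

/-- `i₁` is smooth. [folklore] -/
theorem contMDiff_i₁ : ContMDiff (𝓡 n) (𝓡 n) ∞ D.i₁ := D.contMDiff_symm

/-- `i₁` is continuous. [folklore] -/
theorem continuous_i₁ : Continuous D.i₁ := D.contMDiff_i₁.continuous

/-- `Φ x ≠ 0` for `x ∈ Φ.source`, `x ≠ i₁ 0`. [folklore] -/
theorem Φ_ne_zero {x : X} (hx : x ∈ D.Φ.source) (hx0 : x ≠ D.i₁ 0) : D.Φ x ≠ 0 := fun h =>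
  hx0 (by rw [← D.i₁_Φ hx, h])

/-- `r < ‖Φ x‖` for `x ∈ Φ.source` outside `i₁(B̄(0, r))`. [folklore] -/
theorem lt_norm_Φ {x : X} (hx : x ∈ D.Φ.source) {r : ℝ}
    (hxr : x ∉ D.i₁ '' Metric.closedBall 0 r) : r < ‖D.Φ x‖ := by
  by_contra h
  exact hxr ⟨D.Φ x, by simpa using not_lt.mp h, D.i₁_Φ hx⟩

/-- `i₁` maps open sets to open sets. [folklore] -/
theorem isOpen_image_i₁ {s : Set (EuclideanSpace ℝ (Fin n))} (hs : IsOpen s) :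
    IsOpen (D.i₁ '' s) :=
  D.Φ.symm.isOpen_image_of_subset_source hs
    (by rw [D.Φ.symm_source, D.target_eq]; exact subset_univ _)

/-- The open piece `i₁(B(0, 1))`. [folklore] -/
def Uβ : TopologicalSpace.Opens X := ⟨D.i₁ '' Metric.ball 0 1, D.isOpen_image_i₁ Metric.isOpen_ball⟩

/-- Membership in `Uβ = i₁(B(0, 1))`. [folklore] -/
theorem mem_Uβ {x : X} : x ∈ D.Uβ ↔ x ∈ D.i₁ '' Metric.ball 0 1 := Iff.rfl

/-- `i₁ (g w) ∈ Uβ`, `g` the ball contraction. [folklore] -/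
theorem i₁_ballContraction_mem (w : EuclideanSpace ℝ (Fin n)) :
    D.i₁ (ballContraction w) ∈ D.Uβ :=
  ⟨ballContraction w, by simpa using norm_ballContraction_lt_one w, rfl⟩

section SmoothEmbedding

variable [IsManifold (𝓡 n) ∞ X]

/-- The disc `i₁ = Φ⁻¹ : ℝⁿ → X` is a smooth embedding. [folklore] -/
theorem isSmoothEmbedding_i₁ : Manifold.IsSmoothEmbedding (𝓡 n) (𝓡 n) ∞ D.i₁ :=
  isSmoothEmbedding_of_openPartialHomeomorph (I := 𝓡 n) (J := 𝓡 n) (n := ∞) D.Φ.symm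
    (by rw [D.Φ.symm_source, D.target_eq]) D.contMDiff_symm.contMDiffOn
    (by rw [D.Φ.symm_target, D.Φ.symm_symm]; exact D.contMDiffOn_Φ)
    (ContinuousLinearEquiv.refl ℝ _)

end SmoothEmbedding

/-! #### The diffeomorphism `α : X ∖ {i₁ 0} ≅ X ∖ i₁(B̄(0, 1/8))` (transport of the puncture
expansion along `Φ`) -/

section Alpha

variable [T2Space X]

/-- The open piece `X ∖ i₁(B̄(0, 1/8))`. [folklore] -/
def Uα : TopologicalSpace.Opens X :=
  ⟨(D.i₁ '' Metric.closedBall 0 8⁻¹)ᶜ,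
    (((isCompact_closedBall _ _).image D.continuous_i₁).isClosed).isOpen_compl⟩

/-- Membership in `Uα = X ∖ i₁(B̄(0, 1/8))`. [folklore] -/
theorem mem_Uα {x : X} : x ∈ D.Uα ↔ x ∉ D.i₁ '' Metric.closedBall 0 8⁻¹ := Iff.rfl

/-- `Uα ∪ Uβ = X` (as `1/8 < 1`). [folklore] -/
theorem Uα_union_Uβ : (D.Uα : Set X) ∪ D.Uβ = univ := by
  refine eq_univ_of_forall fun x => ?_
  by_cases hx : x ∈ D.i₁ '' Metric.closedBall 0 8⁻¹
  · obtain ⟨z, hz, rfl⟩ := hx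
    refine Or.inr ⟨z, ?_, rfl⟩
    rw [Metric.mem_closedBall, dist_zero_right] at hz
    rw [Metric.mem_ball, dist_zero_right]
    linarith [show (8 : ℝ)⁻¹ < 1 by norm_num]
  · exact Or.inl hx

/-- The transport of the puncture expansion `h` along `Φ` maps `X ∖ {i₁ 0}` into `Uα`. [folklore] -/
theorem chartTransport_expansion_mem (a : ↥(puncture D.i₁)) :
    chartTransport D.Φ punctureExpansion (a : X) ∈ D.Uα := by
  rw [mem_Uα]
  by_cases ha : (a : X) ∈ D.Φ.source
  · rw [chartTransport_of_mem _ ha]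
    rintro ⟨z, hz, hz'⟩
    have hz'' : z = punctureExpansion (D.Φ a) := D.injective_i₁ hz'
    have h1 := lt_norm_punctureExpansion (D.Φ_ne_zero ha a.2)
    rw [← hz''] at h1
    rw [Metric.mem_closedBall, dist_zero_right] at hz
    exact absurd hz (not_le.mpr h1)
  · rw [chartTransport_of_not_mem _ ha]
    rintro ⟨z, -, hz'⟩
    exact ha (hz' ▸ D.i₁_mem_source z)

/-- The transport of `h⁻¹` along `Φ` maps `Uα` into `X ∖ {i₁ 0}`. [folklore] -/
theorem chartTransport_expansionInv_mem (x : ↥D.Uα) :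
    chartTransport D.Φ punctureExpansionInv (x : X) ∈ puncture D.i₁ := by
  rw [mem_puncture]
  by_cases hx : (x : X) ∈ D.Φ.source
  · rw [chartTransport_of_mem _ hx]
    intro h
    have h0 : punctureExpansionInv (D.Φ x) = 0 := D.injective_i₁ h
    exact punctureExpansionInv_ne_zero (D.lt_norm_Φ hx x.2) h0
  · rw [chartTransport_of_not_mem _ hx]
    intro h
    exact hx (h ▸ D.i₁_mem_source 0)

/-- The transport of `h` along `Φ` is smooth on `X ∖ {i₁ 0}`. [folklore] -/
theorem contMDiffOn_chartTransport_expansion :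
    ContMDiffOn (𝓡 n) (𝓡 n) ∞ (chartTransport D.Φ punctureExpansion) (puncture D.i₁ : Set X) := by
  refine (contMDiffOn_chartTransport (φ := D.Φ) D.contMDiffOn_Φ D.contMDiff_symm D.target_eq
    isOpen_compl_singleton (contMDiffOn_iff_contDiffOn.mpr contDiffOn_punctureExpansion)
    (R := 3 / 4) (fun y hy => punctureExpansion_eq_self hy)).mono fun x hx hxs => ?_
  exact D.Φ_ne_zero hxs hx

/-- The transport of `h⁻¹` along `Φ` is smooth on `Uα`. [folklore] -/
theorem contMDiffOn_chartTransport_expansionInv :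
    ContMDiffOn (𝓡 n) (𝓡 n) ∞ (chartTransport D.Φ punctureExpansionInv) (D.Uα : Set X) := by
  refine (contMDiffOn_chartTransport (φ := D.Φ) D.contMDiffOn_Φ D.contMDiff_symm D.target_eq
    Metric.isClosed_closedBall.isOpen_compl
    (contMDiffOn_iff_contDiffOn.mpr contDiffOn_punctureExpansionInv)
    (R := 3 / 4) (fun y hy => punctureExpansionInv_eq_self hy)).mono fun x hx hxs => ?_
  simpa using D.lt_norm_Φ hxs hx

/-- **`α : X ∖ {i₁ 0} ≅ X ∖ i₁(B̄(0, 1/8))`**, the puncture expansion `h` transported along the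
chart `Φ` (`Φ⁻¹ ∘ h ∘ Φ` on `Φ.source`, the identity elsewhere). [folklore] -/
def α : ↥(puncture D.i₁) ≃ₘ⟮𝓡 n, 𝓡 n⟯ ↥D.Uα where
  toFun a := ⟨chartTransport D.Φ punctureExpansion a, D.chartTransport_expansion_mem a⟩
  invFun x := ⟨chartTransport D.Φ punctureExpansionInv x, D.chartTransport_expansionInv_mem x⟩
  left_inv a := by
    apply Subtype.ext
    show chartTransport D.Φ punctureExpansionInv (chartTransport D.Φ punctureExpansion a) = a
    by_cases ha : (a : X) ∈ D.Φ.source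
    · rw [chartTransport_of_mem _ ha, chartTransport_symm_apply D.target_eq,
        punctureExpansionInv_punctureExpansion (D.Φ_ne_zero ha a.2), D.Φ.left_inv ha]
    · rw [chartTransport_of_not_mem _ ha, chartTransport_of_not_mem _ ha]
  right_inv x := by
    apply Subtype.ext
    show chartTransport D.Φ punctureExpansion (chartTransport D.Φ punctureExpansionInv x) = x
    by_cases hx : (x : X) ∈ D.Φ.source
    · rw [chartTransport_of_mem _ hx, chartTransport_symm_apply D.target_eq,
        punctureExpansion_punctureExpansionInv (D.lt_norm_Φ hx x.2), D.Φ.left_inv hx]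
    · rw [chartTransport_of_not_mem _ hx, chartTransport_of_not_mem _ hx]
  contMDiff_toFun := by
    refine (ContMDiff.subtypeVal_comp_iff _ _).mp ?_
    exact D.contMDiffOn_chartTransport_expansion.comp_contMDiff contMDiff_subtype_val
      fun a => a.2
  contMDiff_invFun := by
    refine (ContMDiff.subtypeVal_comp_iff _ _).mp ?_
    exact D.contMDiffOn_chartTransport_expansionInv.comp_contMDiff contMDiff_subtype_val
      fun x => x.2

/-- `α` acts as the transport of `h` along `Φ`. [folklore] -/
theorem coe_α (a : ↥(puncture D.i₁)) : (D.α a : X) = chartTransport D.Φ punctureExpansion a := rfl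

end Alpha

/-! #### The round disc `i₂ = σᵥ⁻¹ ∘ S₀` and the diffeomorphism `β : S ∖ {-v} ≅ i₁(B(0, 1))` -/

section Sphere

variable [InnerProductSpace ℝ V] [Fact (finrank ℝ V = n + 1)]

/-- The round disc `i₂ = σᵥ⁻¹ ∘ S₀ : ℝⁿ → S`. [folklore] -/
def i₂ : EuclideanSpace ℝ (Fin n) → sphere (0 : V) 1 := (stereographic' n D.v).symm ∘ D.S₀

/-- `i₂ y = σᵥ⁻¹ (S₀ y)`. [folklore] -/
theorem i₂_apply (y : EuclideanSpace ℝ (Fin n)) : D.i₂ y = (stereographic' n D.v).symm (D.S₀ y) :=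
  rfl

/-- `i₂ 0 = -v`: the round disc is centred at the antipode of the pole. [folklore] -/
theorem i₂_zero : D.i₂ 0 = -D.v := by
  rw [i₂_apply, map_zero, stereographic'_symm_zero]

/-- `i₂` is injective. [folklore] -/
theorem injective_i₂ : Injective D.i₂ := fun y y' h => by
  have h' := congrArg (stereographic' n D.v) h
  rwa [i₂_apply, i₂_apply,
    (stereographic' n D.v).right_inv (by rw [stereographic'_target]; trivial),
    (stereographic' n D.v).right_inv (by rw [stereographic'_target]; trivial),
    D.S₀.injective.eq_iff] at h'

/-- The round disc `i₂ = σᵥ⁻¹ ∘ S₀ : ℝⁿ → S` is a smooth embedding. [folklore] -/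
theorem isSmoothEmbedding_i₂ : Manifold.IsSmoothEmbedding (𝓡 n) (𝓡 n) ∞ D.i₂ := by
  have h1 : Manifold.IsSmoothEmbedding (𝓡 n) (𝓡 n) ∞ (stereographic' n D.v).symm :=
    isSmoothEmbedding_of_openPartialHomeomorph (I := 𝓡 n) (J := 𝓡 n) (n := ∞)
      (stereographic' n D.v).symm
      (by rw [(stereographic' n D.v).symm_source, stereographic'_target])
      (contMDiff_stereographic'_symm D.v).contMDiffOn
      (by
        rw [(stereographic' n D.v).symm_target, (stereographic' n D.v).symm_symm,
          stereographic'_source]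
        exact contMDiffOn_stereographic' D.v)
      (ContinuousLinearEquiv.refl ℝ _)
  exact h1.comp_diffeomorph D.S₀.toContinuousLinearEquiv.toDiffeomorph

/-- The reflection of the sphere in `vᗮ` maps `S ∖ {-v}` into the domain `S ∖ {v}` of `σᵥ`.
[folklore] -/
theorem poleReflectionSphere_ne {b : sphere (0 : V) 1} (hb : b ≠ -D.v) :
    poleReflectionSphere (n := n) D.v b ≠ D.v := fun h => hb (by
  rw [← poleReflectionSphere_poleReflectionSphere (n := n) D.v b, h, poleReflectionSphere_pole])

/-- `R b ∈ σᵥ.source` for `b ≠ -v` (`R` the reflection in `vᗮ`). [folklore] -/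
theorem poleReflectionSphere_mem_source {b : sphere (0 : V) 1} (hb : b ≠ -D.v) :
    poleReflectionSphere (n := n) D.v b ∈ (stereographic' n D.v).source := by
  rw [stereographic'_source]
  exact D.poleReflectionSphere_ne hb

/-- The chart `c = σᵥ ∘ R` of `S ∖ {-v}` (with `R` the reflection in `vᗮ`). [folklore] -/
def c (b : sphere (0 : V) 1) : EuclideanSpace ℝ (Fin n) :=
  stereographic' n D.v (poleReflectionSphere (n := n) D.v b)

/-- **Inversion formula**: `c (σᵥ⁻¹ z) = (4 / ‖z‖²) • z` for `z ≠ 0`. [folklore] -/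
theorem c_stereographic'_symm {z : EuclideanSpace ℝ (Fin n)} (hz : z ≠ 0) :
    D.c ((stereographic' n D.v).symm z) = (4 / ‖z‖ ^ 2) • z := by
  have h1 : poleReflectionSphere (n := n) D.v ((stereographic' n D.v).symm z) =
      (stereographic' n D.v).symm ((4 / ‖z‖ ^ 2) • z) :=
    Subtype.ext (by
      rw [LinearIsometryEquiv.coe_sphereDiffeomorph_apply]
      exact poleReflection_stereographic'_symm D.v hz)
  rw [c, h1]
  exact (stereographic' n D.v).right_inv (by rw [stereographic'_target]; trivial)

/-- `c (i₂ ((1 - t) • u)) = (4 / (1 - t)) • S₀ u` for `‖u‖ = 1`, `t < 1`. [folklore] -/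
theorem c_i₂_smul {u : EuclideanSpace ℝ (Fin n)} (hu : ‖u‖ = 1) {t : ℝ} (ht : t < 1) :
    D.c (D.i₂ ((1 - t) • u)) = (4 / (1 - t)) • D.S₀ u := by
  have h1t : 0 < 1 - t := by linarith
  have hz : D.S₀ ((1 - t) • u) ≠ 0 := by
    rw [← norm_ne_zero_iff, LinearIsometryEquiv.norm_map, norm_smul, hu, mul_one,
      Real.norm_of_nonneg h1t.le]
    exact h1t.ne'
  rw [i₂_apply, D.c_stereographic'_symm hz, LinearIsometryEquiv.norm_map, norm_smul, hu, mul_one,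
    Real.norm_of_nonneg h1t.le, map_smul, smul_smul]
  congr 1
  field_simp

/-- The inverse formula `R (σᵥ⁻¹ (S₀ (g⁻¹ (Φ x))))` for `β` lands in `S ∖ {-v}` (`x ∈ Uβ`).
[folklore] -/
theorem βinv_mem (x : ↥D.Uβ) :
    poleReflectionSphere (n := n) D.v
      ((stereographic' n D.v).symm (D.S₀ (ballContractionInv (D.Φ x)))) ∈ puncture D.i₂ := by
  rw [mem_puncture, i₂_zero]
  intro h
  have hRneg : poleReflectionSphere (n := n) D.v (-D.v) = D.v := by
    conv_lhs => rw [← poleReflectionSphere_pole (n := n) D.v]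
    exact poleReflectionSphere_poleReflectionSphere _ _
  have h' := congrArg (poleReflectionSphere (n := n) D.v) h
  rw [poleReflectionSphere_poleReflectionSphere, hRneg] at h'
  exact stereographic'_symm_ne D.v _ h'

/-- `c = σᵥ ∘ R` is smooth on `S ∖ {-v}`. [folklore] -/
theorem contMDiff_c_comp : ContMDiff (𝓡 n) (𝓡 n) ∞ (fun b : ↥(puncture D.i₂) => D.c b) := by
  refine (contMDiffOn_stereographic' D.v).comp_contMDiff
    ((poleReflectionSphere (n := n) D.v).contMDiff.comp contMDiff_subtype_val) fun b => ?_
  exact D.poleReflectionSphere_ne (D.i₂_zero ▸ b.2)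

/-- **`β : S ∖ {-v} ≅ i₁(B(0,1))`**, `β = i₁ ∘ g ∘ S₀⁻¹ ∘ σᵥ ∘ R` with `g` the ball contraction.
[folklore] -/
def β : ↥(puncture D.i₂) ≃ₘ⟮𝓡 n, 𝓡 n⟯ ↥D.Uβ where
  toFun b := ⟨D.i₁ (ballContraction (D.S₀.symm (D.c b))), D.i₁_ballContraction_mem _⟩
  invFun x := ⟨poleReflectionSphere (n := n) D.v
      ((stereographic' n D.v).symm (D.S₀ (ballContractionInv (D.Φ x)))), D.βinv_mem x⟩
  left_inv b := by
    apply Subtype.ext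
    have hb : (b : sphere (0 : V) 1) ≠ -D.v := D.i₂_zero ▸ b.2
    show poleReflectionSphere (n := n) D.v ((stereographic' n D.v).symm (D.S₀ (ballContractionInv
      (D.Φ (D.i₁ (ballContraction (D.S₀.symm (D.c b)))))))) = b
    rw [D.Φ_i₁, ballContractionInv_ballContraction, LinearIsometryEquiv.apply_symm_apply, c,
      (stereographic' n D.v).left_inv (D.poleReflectionSphere_mem_source hb),
      poleReflectionSphere_poleReflectionSphere]
  right_inv x := by
    apply Subtype.ext
    obtain ⟨y, hy, hyx⟩ := (D.mem_Uβ).mp x.2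
    show D.i₁ (ballContraction (D.S₀.symm (D.c (poleReflectionSphere (n := n) D.v
      ((stereographic' n D.v).symm (D.S₀ (ballContractionInv (D.Φ x)))))))) = x
    rw [c, poleReflectionSphere_poleReflectionSphere,
      (stereographic' n D.v).right_inv (by rw [stereographic'_target]; trivial),
      LinearIsometryEquiv.symm_apply_apply, ← hyx, D.Φ_i₁,
      ballContraction_ballContractionInv (by simpa using hy)]
  contMDiff_toFun := by
    refine (ContMDiff.subtypeVal_comp_iff _ _).mp ?_
    exact D.contMDiff_i₁.comp ((contDiff_ballContraction.contMDiff).comp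
      (D.S₀.symm.toContinuousLinearEquiv.contDiff.contMDiff.comp D.contMDiff_c_comp))
  contMDiff_invFun := by
    refine (ContMDiff.subtypeVal_comp_iff _ _).mp ?_
    have h1 : ContMDiff (𝓡 n) (𝓡 n) ∞ (fun x : ↥D.Uβ => D.Φ x) :=
      D.contMDiffOn_Φ.comp_contMDiff contMDiff_subtype_val fun x => by
        obtain ⟨y, -, hyx⟩ := (D.mem_Uβ).mp x.2
        rw [← hyx]; exact D.i₁_mem_source y
    have h2 : ContMDiff (𝓡 n) (𝓡 n) ∞ (fun x : ↥D.Uβ => ballContractionInv (D.Φ x)) :=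
      (contMDiffOn_iff_contDiffOn.mpr contDiffOn_ballContractionInv).comp_contMDiff h1 fun x => by
        obtain ⟨y, hy, hyx⟩ := (D.mem_Uβ).mp x.2
        rw [← hyx, D.Φ_i₁]; exact hy
    exact (poleReflectionSphere (n := n) D.v).contMDiff.comp
      ((contMDiff_stereographic'_symm D.v).comp
        (D.S₀.toContinuousLinearEquiv.contDiff.contMDiff.comp h2))

/-- `β b = i₁ (g (S₀⁻¹ (c b)))`. [folklore] -/
theorem coe_β (b : ↥(puncture D.i₂)) :
    (D.β b : X) = D.i₁ (ballContraction (D.S₀.symm (D.c b))) := rfl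

end Sphere

/-! #### The relation, the standard model and its consequences -/

section Model

variable [InnerProductSpace ℝ V] [Fact (finrank ℝ V = n + 1)] [T2Space X]

/-- **The pieces meet exactly along Kervaire–Milnor's relation**: `α a = β b` in `X` iff
`a = i₁ (t • u)` and `b = i₂ ((1 - t) • u)` for some unit vector `u` and `t ∈ (0, 1)`.
[cite: KervaireMilnor1963, §2] -/
theorem α_eq_β_iff (a : ↥(puncture D.i₁)) (b : ↥(puncture D.i₂)) :
    (D.α a : X) = (D.β b : X) ↔ connectedSumRel D.i₁ D.i₂ a b := by
  rw [coe_α, coe_β]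
  have hb : (b : sphere (0 : V) 1) ≠ -D.v := D.i₂_zero ▸ b.2
  constructor
  · intro heq
    by_cases ha : (a : X) ∈ D.Φ.source
    swap
    · rw [chartTransport_of_not_mem _ ha] at heq
      exact absurd (heq ▸ D.i₁_mem_source _) ha
    rw [chartTransport_of_mem _ ha] at heq
    have hz0 : D.Φ a ≠ 0 := D.Φ_ne_zero ha a.2
    have hhg : punctureExpansion (D.Φ a) = ballContraction (D.S₀.symm (D.c b)) :=
      D.injective_i₁ heq
    have hn1 : ‖D.Φ a‖ < 1 := by
      refine norm_lt_one_of_norm_punctureExpansion_lt_one hz0 ?_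
      rw [hhg]; exact norm_ballContraction_lt_one _
    set t : ℝ := ‖D.Φ a‖ with ht
    have ht0 : 0 < t := norm_pos_iff.mpr hz0
    set u : EuclideanSpace ℝ (Fin n) := t⁻¹ • D.Φ a with hu
    have hu1 : ‖u‖ = 1 := by
      rw [hu, norm_smul, norm_inv, Real.norm_of_nonneg ht0.le, inv_mul_cancel₀ ht0.ne']
    have hzu : D.Φ a = t • u := by rw [hu, smul_smul, mul_inv_cancel₀ ht0.ne', one_smul]
    refine ⟨u, t, hu1, ⟨ht0, hn1⟩, ?_, ?_⟩
    · rw [← hzu, D.i₁_Φ ha]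
    · have h1 : ballContraction (D.S₀.symm (D.c b)) = ballContraction ((4 / (1 - t)) • u) := by
        rw [← hhg, hzu, punctureExpansion_smul_eq hu1 ⟨ht0, hn1⟩]
      have h2 : D.c b = (4 / (1 - t)) • D.S₀ u := by
        have h3 := congrArg D.S₀ (injective_ballContraction h1)
        rwa [LinearIsometryEquiv.apply_symm_apply, map_smul] at h3
      rw [← D.c_i₂_smul hu1 hn1] at h2
      have hb₀ : D.i₂ ((1 - t) • u) ≠ -D.v := by
        rw [← i₂_zero]
        intro h5
        have h6 : (1 - t) • u = 0 := D.injective_i₂ h5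
        rw [smul_eq_zero] at h6
        rcases h6 with h6 | h6
        · linarith
        · rw [h6, norm_zero] at hu1
          exact zero_ne_one hu1
      have h4 : poleReflectionSphere (n := n) D.v b =
          poleReflectionSphere (n := n) D.v (D.i₂ ((1 - t) • u)) :=
        (stereographic' n D.v).injOn (D.poleReflectionSphere_mem_source hb)
          (D.poleReflectionSphere_mem_source hb₀) h2
      have h5 := congrArg (poleReflectionSphere (n := n) D.v) h4
      rwa [poleReflectionSphere_poleReflectionSphere,
        poleReflectionSphere_poleReflectionSphere] at h5
  · rintro ⟨u, t, hu1, ht, ha, hb'⟩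
    have has : (a : X) ∈ D.Φ.source := ha ▸ D.i₁_mem_source _
    rw [chartTransport_of_mem _ has, ha, D.Φ_i₁, punctureExpansion_smul_eq hu1 ht, hb',
      D.c_i₂_smul hu1 ht.2, map_smul, LinearIsometryEquiv.symm_apply_apply]
    rfl

variable [IsManifold (𝓡 n) ∞ X]

/-- **The standard model of `X # Sⁿ ≅ X`**: `X` itself is the open gluing of `X ∖ {i₁ 0}` and
`S ∖ {i₂ 0}` along Kervaire–Milnor's relation for the discs `i₁ = Φ⁻¹` and the round disc
`i₂ = σᵥ⁻¹ ∘ S₀` — the embeddings being `α⁻¹ : X ∖ i₁(B̄(0, 1/8)) ⊆ X` composed with `α` and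
`β : S ∖ {-v} ≅ i₁(B(0, 1)) ⊆ X` (Kervaire–Milnor 1963, §2, "`Sⁿ` serves as identity element";
Kosinski, *Differential Manifolds*, VI.1.3). [cite: KervaireMilnor1963, §2] -/
theorem isOpenGluing_connectedSumRel :
    IsOpenGluing (𝓡 n) (𝓡 n) (𝓡 n) (A := ↥(puncture D.i₁)) (B := ↥(puncture D.i₂)) (P := X)
      (connectedSumRel D.i₁ D.i₂) :=
  ((IsOpenGluing.of_opens_union_eq_univ D.Uα D.Uβ D.Uα_union_Uβ).comp_diffeomorph_pieces
    D.α D.β).of_forall_iff fun a b => D.α_eq_β_iff a b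

/-- Along a diffeomorphism `Ψ` of the sphere which agrees with `i₂ ↦ i₂'` on the closed unit
disc (`Ψ (i₂ y) = i₂' y` for `‖y‖ ≤ 1`, as furnished by Palais' disc theorem,
`exists_diffeomorph_apply_stereographic_symm_eq` of `PalaisDiscSphere.lean`), an open gluing
of `X ∖ {i₁ 0}` and `S ∖ {i₂' 0}` along Kervaire–Milnor's relation for `(i₁, i₂')` is also one
of `X ∖ {i₁ 0}` and `S ∖ {i₂ 0}` along the relation for `(i₁, i₂)`: compose the second
embedding with the restriction `S ∖ {i₂ 0} ≅ S ∖ {i₂' 0}` of `Ψ`; the relation only involves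
points of the unit discs. [cite: KervaireMilnor1963, §2] -/
theorem isOpenGluing_of_diffeomorph_apply_eq {Q : Type*} [TopologicalSpace Q]
    [ChartedSpace (EuclideanSpace ℝ (Fin n)) Q] {i₁ : EuclideanSpace ℝ (Fin n) → X}
    {i₂' : EuclideanSpace ℝ (Fin n) → sphere (0 : V) 1}
    (Ψ : (sphere (0 : V) 1) ≃ₘ⟮𝓡 n, 𝓡 n⟯ (sphere (0 : V) 1))
    (hΨ : ∀ y : EuclideanSpace ℝ (Fin n), ‖y‖ ≤ 1 → Ψ (D.i₂ y) = i₂' y)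
    (hG : IsOpenGluing (𝓡 n) (𝓡 n) (𝓡 n) (A := ↥(puncture i₁)) (B := ↥(puncture i₂')) (P := Q)
      (connectedSumRel i₁ i₂')) :
    IsOpenGluing (𝓡 n) (𝓡 n) (𝓡 n) (A := ↥(puncture i₁)) (B := ↥(puncture D.i₂)) (P := Q)
      (connectedSumRel i₁ D.i₂) := by
  have h0 : Ψ (D.i₂ 0) = i₂' 0 := hΨ 0 (by simp)
  have hmem : ∀ b : sphere (0 : V) 1, b ∈ puncture D.i₂ ↔ Ψ b ∈ puncture i₂' := fun b => by
    rw [mem_puncture, mem_puncture, ← h0]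
    exact ⟨fun h h' => h (Ψ.injective h'), fun h h' => h (congrArg Ψ h')⟩
  refine (hG.comp_diffeomorph_pieces (Diffeomorph.refl (𝓡 n) (↥(puncture i₁)) ∞)
    (opensCongr Ψ (puncture D.i₂) (puncture i₂') hmem)).of_forall_iff fun a b => ?_
  have hn1 : ∀ (u : EuclideanSpace ℝ (Fin n)) (t : ℝ), ‖u‖ = 1 → t ∈ Ioo (0 : ℝ) 1 →
      ‖(1 - t) • u‖ ≤ 1 := fun u t hu ht => by
    rw [norm_smul, hu, mul_one, Real.norm_of_nonneg (by linarith [ht.2])]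
    linarith [ht.1]
  simp only [Diffeomorph.coe_refl, id_eq]
  constructor
  · rintro ⟨u, t, hu, ht, ha, hb⟩
    have h1 : Ψ b = Ψ (D.i₂ ((1 - t) • u)) := by
      rw [hΨ _ (hn1 u t hu ht), ← hb, coe_opensCongr_apply]
    exact ⟨u, t, hu, ht, ha, Ψ.injective h1⟩
  · rintro ⟨u, t, hu, ht, ha, hb⟩
    refine ⟨u, t, hu, ht, ha, ?_⟩
    rw [← hΨ _ (hn1 u t hu ht), ← hb]
    rfl

/-- **`X # Sⁿ ≅ X`, the uniqueness step**: if `Q` is an open gluing of `X ∖ {i₁ 0}` and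
`S ∖ {i₂' 0}` along Kervaire–Milnor's relation, where `i₁ = Φ⁻¹` and the disc `i₂'` agrees on
the closed unit disc with `Ψ ∘ i₂`, `i₂ = σᵥ⁻¹ ∘ S₀` round, then `Q ≅ X`, by the standard model
and uniqueness of open gluings (`IsOpenGluing.nonempty_diffeomorph`).
[cite: KervaireMilnor1963, §2] -/
theorem nonempty_diffeomorph_of_isOpenGluing {Q : Type*} [TopologicalSpace Q]
    [ChartedSpace (EuclideanSpace ℝ (Fin n)) Q] [IsManifold (𝓡 n) ∞ Q]
    {i₂' : EuclideanSpace ℝ (Fin n) → sphere (0 : V) 1}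
    (Ψ : (sphere (0 : V) 1) ≃ₘ⟮𝓡 n, 𝓡 n⟯ (sphere (0 : V) 1))
    (hΨ : ∀ y : EuclideanSpace ℝ (Fin n), ‖y‖ ≤ 1 → Ψ (D.i₂ y) = i₂' y)
    (hG : IsOpenGluing (𝓡 n) (𝓡 n) (𝓡 n) (A := ↥(puncture D.i₁)) (B := ↥(puncture i₂')) (P := Q)
      (connectedSumRel D.i₁ i₂')) :
    Nonempty (Q ≃ₘ⟮𝓡 n, 𝓡 n⟯ X) :=
  (D.isOpenGluing_of_diffeomorph_apply_eq Ψ hΨ hG).nonempty_diffeomorph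
    D.isOpenGluing_connectedSumRel


end Model

end ConnectedSumSphereData

end StandardModel

/-! ### §3 The named facts -/

section Facts

/-- Local notation: `𝔼 n` is the model Euclidean space `EuclideanSpace ℝ (Fin n)`. -/
local notation "𝔼 " n:arg => EuclideanSpace ℝ (Fin n)

/-- Local notation: `𝕊 n` is the unit sphere in `EuclideanSpace ℝ (Fin (n + 1))`. -/
local notation "𝕊 " n:arg => (Metric.sphere (0 : EuclideanSpace ℝ (Fin (n + 1))) 1)

/-- **`X # Sⁿ ≅ X` for every connected sum with the standard sphere** (general form: arbitrary
universes, `X` Hausdorff, no second countability): given `Q = (X ∖ {i₁ 0}) ∪ (Sⁿ ∖ {i₂ 0})`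
glued along Kervaire–Milnor's relation for arbitrary discs `i₁ : ℝⁿ ↪ X`, `i₂ : ℝⁿ ↪ Sⁿ`,
Palais' disc theorem (`exists_diffeomorph_apply_stereographic_symm_eq`, `PalaisDiscSphere.lean`)
moves `i₂|𝔻` to a round disc `σᵥ⁻¹ ∘ S₀|𝔻` by a diffeomorphism of `Sⁿ`, the chart `Φ = i₁⁻¹`
(`exists_chart_of_isSmoothEmbedding`) gives the standard model
`X = (X ∖ {i₁ 0}) ∪ (Sⁿ ∖ {-v})` along the same relation
(`ConnectedSumSphereData.isOpenGluing_connectedSumRel`), and uniqueness of open gluings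
(`IsOpenGluing.nonempty_diffeomorph`) identifies `Q` with `X` (Kervaire–Milnor 1963, §2,
"`Sⁿ` serves as identity element", with Lemma 2.1; Kosinski, *Differential Manifolds* (1993),
VI.1.3). [cite: KervaireMilnor1963, §2] -/
theorem nonempty_diffeomorph_of_isConnectedSum_sphere' {n : ℕ} {X Q : Type*} [TopologicalSpace X]
    [T2Space X] [ChartedSpace (𝔼 n) X] [IsManifold (𝓡 n) ∞ X] [TopologicalSpace Q]
    [ChartedSpace (𝔼 n) Q] [IsManifold (𝓡 n) ∞ Q]
    (h : IsConnectedSum (𝓡 n) (𝓡 n) (𝓡 n) X (𝕊 n) Q) : Nonempty (Q ≃ₘ⟮𝓡 n, 𝓡 n⟯ X) := by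
  haveI : Fact (finrank ℝ (EuclideanSpace ℝ (Fin (n + 1))) = n + 1) := ⟨finrank_euclideanSpace_fin⟩
  obtain ⟨i₁, i₂, h₁, h₂, hG⟩ := h
  obtain ⟨Φ, hΦt, hΦe, -, hΦc⟩ := exists_chart_of_isSmoothEmbedding h₁
  subst hΦe
  obtain ⟨Ψ, B, hΨ⟩ := exists_diffeomorph_apply_stereographic_symm_eq h₂
  refine ConnectedSumSphereData.nonempty_diffeomorph_of_isOpenGluing
    ⟨Φ, hΦt, hΦc, h₁.contMDiff, -i₂ 0, B.symm⟩ Ψ (fun y hy => ?_) hG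
  have h := hΨ (B.symm y) (by rwa [LinearIsometryEquiv.norm_map])
  rwa [LinearIsometryEquiv.apply_symm_apply] at h

/-- **`X # Sⁿ ≅ X`** — discharge of the named fact
`Literature.Topology.FourManifolds.nonempty_diffeomorph_of_isConnectedSum_sphere` (`CorkDecompositionSplitting.lean`, the
leaf (U) under Matveyev's cork decomposition): the instance `X Q : Type u`, `X`, `Q` Hausdorff
and second countable, of
`nonempty_diffeomorph_of_isConnectedSum_sphere'` (Kervaire–Milnor 1963, §2, "`Sⁿ` serves as
identity element"). [cite: KervaireMilnor1963, §2] -/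
theorem nonempty_diffeomorph_of_isConnectedSum_sphere_holds :
    nonempty_diffeomorph_of_isConnectedSum_sphere.{u} :=
  fun _n _X _Q _ _ _ _ _ _ _ _ _ _ h => nonempty_diffeomorph_of_isConnectedSum_sphere' h

/-- **A connected sum of two `n`-spheres is an `n`-sphere** — discharge of the named fact
`Literature.connectedSum_sphere_sphere n` (`ConnectedSumSpheres.lean`; Kervaire–Milnor 1963, Lemma 2.1):
if `P = M # N` with `M ≅ 𝕊ⁿ ≅ N`, transport the `N`-piece to `𝕊ⁿ` itself
(`IsConnectedSum.of_diffeomorph_right`) and apply `X # Sⁿ ≅ X` with `X = M ≅ 𝕊ⁿ`. The hypothesis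
`0 < n` of the fact is not needed. [cite: KervaireMilnor1963, §2, Lemma 2.1 (p. 505)] -/
theorem connectedSum_sphere_sphere_holds (n : ℕ) : connectedSum_sphere_sphere.{u, v, w} n := by
  intro _ M N P _ _ _ _ _ _ _ _ _ _ _ h hM hN
  obtain ⟨φ⟩ := hM
  obtain ⟨ψ⟩ := hN
  obtain ⟨e⟩ := nonempty_diffeomorph_of_isConnectedSum_sphere' (h.of_diffeomorph_right ψ)
  exact ⟨e.trans φ⟩

/-- **`M # 𝕊ⁿ ≅ M` in relational form** — discharge of the named fact
`Literature.Topology.FourManifolds.isConnectedSum_sphere_self` (`ConnectedSum.lean`): a nonempty smooth `n`-manifold `M` is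
the connected sum of itself and `𝕊ⁿ` along the discs `i₁ = Φ⁻¹` (`Φ` a smooth chart onto `ℝⁿ`,
`exists_mem_maximalAtlas_target_eq_univ`) and `i₂ = σᵥ⁻¹` (inverse stereographic projection),
by the standard model `ConnectedSumSphereData.isOpenGluing_connectedSumRel` (Kervaire–Milnor
1963, §2, "`Sⁿ` serves as identity element"; Kosinski, *Differential Manifolds* (1993), VI.1.3).
[cite: KervaireMilnor1963, §2] -/
theorem isConnectedSum_sphere_self_holds {n : ℕ} : isConnectedSum_sphere_self.{u} (n := n) := by
  intro M _ _ _ _ _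
  haveI : Fact (finrank ℝ (EuclideanSpace ℝ (Fin (n + 1))) = n + 1) := ⟨finrank_euclideanSpace_fin⟩
  obtain ⟨x⟩ := ‹Nonempty M›
  obtain ⟨e, he, -, het, -⟩ := exists_mem_maximalAtlas_target_eq_univ (E := 𝔼 n) x
  have hsymm : ContMDiff (𝓡 n) (𝓡 n) ∞ e.symm := by
    have h := contMDiffOn_symm_of_mem_maximalAtlas he
    rwa [het, contMDiffOn_univ] at h
  obtain ⟨p⟩ : Nonempty (𝕊 n) := (NormedSpace.sphere_nonempty.mpr zero_le_one).to_subtype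
  set D : ConnectedSumSphereData (𝔼 (n + 1)) n M :=
    ⟨e, het, contMDiffOn_of_mem_maximalAtlas he, hsymm, p, LinearIsometryEquiv.refl ℝ _⟩
  exact ⟨D.i₁, D.i₂, D.isSmoothEmbedding_i₁, D.isSmoothEmbedding_i₂, D.isOpenGluing_connectedSumRel⟩

end Facts



end Literature.Topology.FourManifolds

end
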